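import Summits.QuantumFields.YangMills.Theses.OnsetCalibration
import Summits.QuantumFields.YangMills.Theorems.LangevinControlUVOSLegsFromFemtoAndGapStubCollar6
import Summits.QuantumFields.YangMills.Theorems.SubOnsetCeilings.Negative.CubeKernelLaplace

/-!
# Crux K2 `SubOnsetCeilings` (stmt-QuantumFields-23313) — negative side: the kernel-licensed reading of the
# instrument row «on-axis plaquette covariance at matched sub-onset resolution»

The instrument row booked by the lead (pub/ym-ir PREREG-E4-G1 §3(d), kill rule K-O1) measures the on-axis,
same-orientation connected plaquette–plaquette correlator `C_pt(R') = Cov(P_q(x), P_q(x + R' e_μ))` on tori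
`(ℤ/(2L+1))⁴` at sub-onset status.  This file records EXACTLY what the crux K2 says about that observable:
the `n = 2`, equal-orientation, on-axis instance of the centred-moment ceilings.  If
`Summit.QuantumFields.YangMills.Theses.OnsetCalibration.SubOnsetCeilings` holds, then for every datum and
live floor level there are `C, ℓ₄, β₄` such that at every sub-onset `(β, s)` (`β ≥ β₄`), on every odd torus
with `4R + 8 ≤ L`, for every collar radius `R ≥ 1` with `R·s ≤ ℓ₄` and every on-axis separation
`2R + 4 ≤ R' ≤ L`:

  `|Cov_{β,L}(P_q(x), P_q(x + R' e_μ))| ≤ (C/R⁴)²`.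

So the K2-licensed reading of the row is: at separations `R' ≥ 6` (collar radius `R = ⌊(R'−4)/2⌋ ≥ 1`),
`C_eff(R') := R'⁴ |C_pt(R')|^{1/2}` stays BOUNDED as `β` grows at matched sub-onset status; readings at
`R' ≤ 5` probe a strengthening of K2, not K2.  (`C` is existential: a single lattice cannot refute; growth in
`β` at fixed admissible `R'` can.)

* `torusE_centredProd_two` — the `n = 2` centred product mean is the covariance (probability measure,
  bounded continuous observables).
* `pair_separated_of_coord_sub_eq` — a pair of sites differing by `R'` along an axis, `2R+4 ≤ R' ≤ L`,
  satisfies K2's torus separation hypothesis.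
* `onAxisCov_le_of_subOnsetCeilings` — the statement above, from the crux BY NAME.

HONEST LABEL: a necessary consequence of K2 for a guidance-grade MC row; nothing here proves or refutes the
crux; no summit, no mass gap.
-/

set_option autoImplicit false

noncomputable section

open scoped SchwartzMap
open MeasureTheory Filter Topology
open Literature.MathematicalPhysics.QuantumFieldTheory hiding ZdEdge
open Literature.MathematicalPhysics.QuantumLattice hiding cubeEdges cubeSites
open Literature.MathematicalPhysics.AQFT Literature.Probability.LatticeModels
open Summit.QuantumFields.YangMills.Cruxes.OSLegsFromFemtoAndGap.DlrCollarTransfer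

namespace Summit.QuantumFields.YangMills.Theorems.SubOnsetCeilings.Negative

section Torus

variable {G : Type} [Group G] [TopologicalSpace G] [IsTopologicalGroup G] [CompactSpace G]
  [MeasurableSpace G] [BorelSpace G] (r : LatticeRep G)

/-- **The `n = 2` centred product mean is the covariance.**  For two single-plane fields on the torus of
side `2L+1`, `E[(P − E P)(P' − E P')] = E[P P'] − E P · E P'` (Wilson's measure is a probability measure
and the fields are bounded continuous). [folklore] -/
theorem torusE_centredProd_two (β : ℝ) (L : ℕ) (q : Fin 2 → Fin 4 × Fin 4) (x : Fin 2 → (Fin 4 → ℤ)) :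
    torusE G r β L (fun U => ∏ i, (plane G r (q i) (x i) U - torusE G r β L (plane G r (q i) (x i)))) =
      torusE G r β L (fun U => plane G r (q 0) (x 0) U * plane G r (q 1) (x 1) U) -
        torusE G r β L (plane G r (q 0) (x 0)) * torusE G r β L (plane G r (q 1) (x 1)) := by
  haveI : SecondCountableTopology G :=
    (r.continuous.isClosedEmbedding r.injective).isEmbedding.secondCountableTopology
  haveI := isProbabilityMeasure_wilsonMeasure (d := 4) (L := 2 * L + 1) r.ρ r.continuous β
  set μW := wilsonMeasure (d := 4) (L := 2 * L + 1) r.ρ β with hμW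
  -- the two lifted fields, bounded and continuous
  let A : GaugeConfig 4 (2 * L + 1) G → ℝ := fun V => plane G r (q 0) (x 0) (torusLift (2 * L + 1) V)
  let B : GaugeConfig 4 (2 * L + 1) G → ℝ := fun V => plane G r (q 1) (x 1) (torusLift (2 * L + 1) V)
  have hAc : Continuous A := (continuous_plane r (q 0) (x 0)).comp (continuous_torusLift (2 * L + 1))
  have hBc : Continuous B := (continuous_plane r (q 1) (x 1)).comp (continuous_torusLift (2 * L + 1))
  have hAb : ∀ V, |A V| ≤ r.N := fun V => abs_plane_le_N r (q 0) (x 0) _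
  have hBb : ∀ V, |B V| ≤ r.N := fun V => abs_plane_le_N r (q 1) (x 1) _
  have hAi : Integrable A μW := Integrable.of_bound hAc.aestronglyMeasurable (r.N : ℝ)
    (Eventually.of_forall fun V => by rw [Real.norm_eq_abs]; exact hAb V)
  have hBi : Integrable B μW := Integrable.of_bound hBc.aestronglyMeasurable (r.N : ℝ)
    (Eventually.of_forall fun V => by rw [Real.norm_eq_abs]; exact hBb V)
  have hABi : Integrable (fun V => A V * B V) μW :=
    Integrable.of_bound (hAc.mul hBc).aestronglyMeasurable ((r.N : ℝ) * r.N)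
      (Eventually.of_forall fun V => by
        rw [Real.norm_eq_abs, abs_mul]
        exact mul_le_mul (hAb V) (hBb V) (abs_nonneg _) ((abs_nonneg _).trans (hAb V)))
  set a : ℝ := torusE G r β L (plane G r (q 0) (x 0)) with ha
  set b : ℝ := torusE G r β L (plane G r (q 1) (x 1)) with hb
  have haE : ∫ V, A V ∂μW = a := rfl
  have hbE : ∫ V, B V ∂μW = b := rfl
  -- expand the centred product
  have hprod : ∀ U : LGConfig 4 G,
      (∏ i, (plane G r (q i) (x i) U - torusE G r β L (plane G r (q i) (x i)))) =
        (plane G r (q 0) (x 0) U - a) * (plane G r (q 1) (x 1) U - b) := fun U => by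
    rw [Fin.prod_univ_two]
  simp_rw [hprod]
  unfold torusE
  change ∫ V, (A V - a) * (B V - b) ∂μW = ∫ V, A V * B V ∂μW - a * b
  have hexp : ∀ V, (A V - a) * (B V - b) = A V * B V - a * B V - b * A V + a * b := fun V => by ring
  simp_rw [hexp]
  have hI2 : Integrable (fun V => a * B V) μW := hBi.const_mul a
  have hI3 : Integrable (fun V => b * A V) μW := hAi.const_mul b
  have hI4 : Integrable (fun V => A V * B V - a * B V) μW := hABi.sub hI2
  have hI5 : Integrable (fun V => A V * B V - a * B V - b * A V) μW := hI4.sub hI3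
  have hI6 : Integrable (fun _ : GaugeConfig 4 (2 * L + 1) G => a * b) μW := integrable_const _
  rw [integral_add hI5 hI6, integral_sub hI4 hI3, integral_sub hABi hI2, integral_const_mul,
    integral_const_mul, integral_const, haE, hbE, probReal_univ, one_smul]
  ring

omit [TopologicalSpace G] [IsTopologicalGroup G] [CompactSpace G] [MeasurableSpace G] [BorelSpace G] in
/-- **On-axis pairs are collar-separated.**  If two sites `y 0, y 1` differ by `R'` in the coordinate `μ`
with `2R + 4 ≤ R' ≤ L`, then their torus separation in `ℤ/(2L+1)` along `μ` is `R' ≥ 2R+4` (K2's separation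
hypothesis for the pair). [folklore] -/
theorem pair_separated_of_coord_sub_eq {L R R' : ℕ} (hRR' : 2 * R + 4 ≤ R') (hR'L : R' ≤ L)
    (y : Fin 2 → (Fin 4 → ℤ)) (μ : Fin 4) (hy : y 1 μ - y 0 μ = R') :
    ∀ i j : Fin 2, i ≠ j → ∃ k : Fin 4, (2 * (R : ℤ) + 4) ≤
      |((((y i k - y j k : ℤ) : ZMod (2 * L + 1))).valMinAbs : ℤ)| := by
  have hval : (((R' : ℤ) : ZMod (2 * L + 1))).valMinAbs = R' := by
    rw [Int.cast_natCast]
    exact ZMod.valMinAbs_natCast_of_le_half (by omega)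
  have hkey : ∀ z : ℤ, (z = R' ∨ z = -R') →
      (2 * (R : ℤ) + 4) ≤ |(((z : ZMod (2 * L + 1))).valMinAbs : ℤ)| := by
    rintro z (rfl | rfl)
    · rw [hval, abs_of_nonneg (by positivity)]; exact_mod_cast hRR'
    · haveI : NeZero (2 * L + 1) := ⟨by omega⟩
      rw [Int.cast_neg, ZMod.valMinAbs_neg_of_ne_half, hval, abs_neg]
      · rw [abs_of_nonneg (by positivity)]; exact_mod_cast hRR'
      · rw [Int.cast_natCast, ZMod.val_natCast, Nat.mod_eq_of_lt (by omega)]; omega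
  have h2 : ∀ i : Fin 2, i ≠ 0 → i = 1 := by decide
  have hy' : y 0 μ - y 1 μ = -R' := by rw [← hy]; ring
  intro i j hij
  refine ⟨μ, ?_⟩
  by_cases hi : i = 0
  · subst hi
    have hj : j = 1 := h2 j (Ne.symm hij)
    subst hj
    exact hkey _ (Or.inr hy')
  · have hi1 : i = 1 := h2 i hi
    subst hi1
    have hj : j = 0 := by
      by_contra hj0
      exact hij (h2 j hj0).symm
    subst hj
    exact hkey _ (Or.inl hy)

end Torus

/-- **K2-licensed reading of the instrument row (on-axis plaquette covariance).**  If the crux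
`SubOnsetCeilings` holds then for every SU(2)-class datum there is `ε₀ > 0` such that for every live floor
level `0 < ε ≤ ε₀` there are `C ≥ 0`, `ℓ₄ > 0`, `β₄` with: for all `β ≥ β₄`, every sub-onset resolution
`s ∈ (0,1]` (no floor on `[2s,1]`), every odd torus `(ℤ/(2L+1))⁴`, orientation `q = (i < j)`, site `x`,
axis `μ`, collar radius `R ≥ 1` with `R·s ≤ ℓ₄`, `4R + 8 ≤ L`, and on-axis separation `2R+4 ≤ R' ≤ L`,
the connected equal-orientation plaquette–plaquette correlator obeys
`|E[P_q(x) P_q(x + R' e_μ)] − E P_q(x) · E P_q(x + R' e_μ)| ≤ (C/R⁴)²`.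
In particular at admissible separations `R' ≥ 6` the combination `R'⁴ |C_pt(R')|^{1/2}` is bounded
uniformly in `β ≥ β₄` at matched sub-onset status — the content of kill rule K-O1. [folklore] -/
theorem onAxisCov_le_of_subOnsetCeilings
    (hK2 : Summit.QuantumFields.YangMills.Theses.OnsetCalibration.SubOnsetCeilings) :
    ∀ (G : Type) [Group G] [TopologicalSpace G] [IsTopologicalGroup G] [CompactSpace G],
      IsCompactSimpleLieGroup G → Nonempty (G ≃ₜ* Matrix.specialUnitaryGroup (Fin 2) ℂ) →
      letI : MeasurableSpace G := borel G
      haveI : BorelSpace G := ⟨rfl⟩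
      ∀ (r : LatticeRep G) (v f g h : 𝓢(EuclideanSpace ℝ (Fin 4), ℝ)) (Λ₅ : ℝ),
        ∃ ε₀ : ℝ, 0 < ε₀ ∧ ∀ ε : ℝ, 0 < ε → ε ≤ ε₀ →
          (∃ β₅ : ℝ, ∀ β : ℝ, β₅ ≤ β → ∃ s : ℝ, 0 < s ∧ s ≤ 1 ∧
            (∀ L : ℕ, Λ₅ ≤ s * L → ε ≤ Q2 G r β L s (thetaTest 4 v) v) ∧
            (∀ L : ℕ, Λ₅ ≤ s * L → ε ≤ |Q3 G r β L s f g h|)) →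
          ∃ (C ℓ₄ β₄ : ℝ), 0 < ℓ₄ ∧ 0 ≤ C ∧ ∀ β : ℝ, β₄ ≤ β → ∀ s : ℝ, 0 < s → s ≤ 1 →
            (∀ s' : ℝ, 2 * s ≤ s' → s' ≤ 1 →
              ¬ ((∀ L : ℕ, Λ₅ ≤ s' * L → ε ≤ Q2 G r β L s' (thetaTest 4 v) v) ∧
                 (∀ L : ℕ, Λ₅ ≤ s' * L → ε ≤ |Q3 G r β L s' f g h|))) →
            ∀ (L : ℕ) (q : Fin 4 × Fin 4) (x : Fin 4 → ℤ) (μ : Fin 4) (R R' : ℕ), q.1 < q.2 → 1 ≤ R →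
              (R : ℝ) * s ≤ ℓ₄ → 4 * R + 8 ≤ L → 2 * R + 4 ≤ R' → R' ≤ L →
              |torusE G r β L (fun U => plane G r q x U * plane G r q (x + Pi.single μ (R' : ℤ)) U) -
                  torusE G r β L (plane G r q x) * torusE G r β L (plane G r q (x + Pi.single μ (R' : ℤ)))| ≤
                (C / (R : ℝ) ^ 4) ^ 2 := by
  intro G _ _ _ _ hG hcl
  letI : MeasurableSpace G := borel G
  haveI : BorelSpace G := ⟨rfl⟩
  intro r v f g h Λ₅
  have hK := hK2 G hG hcl r v f g h Λ₅
  obtain ⟨ε₀, hε₀, hK'⟩ := hK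
  refine ⟨ε₀, hε₀, fun ε hε hεle hlive => ?_⟩
  obtain ⟨C, ℓ₄, β₄, hℓ₄, hC, hceil⟩ := hK' ε hε hεle hlive
  refine ⟨C, ℓ₄, β₄, hℓ₄, hC, ?_⟩
  intro β hβ s hs0 hs1 hsub L q x μ R R' hq hR hRs hRL hRR' hR'L
  -- the on-axis pair as a `Fin 2`-family
  let y : Fin 2 → (Fin 4 → ℤ) := fun i => if i = 0 then x else x + Pi.single μ (R' : ℤ)
  have e0 : y 0 = x := if_pos rfl
  have e1 : y 1 = x + Pi.single μ (R' : ℤ) := if_neg (by decide)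
  have hy : y 1 μ - y 0 μ = R' := by
    rw [e0, e1, Pi.add_apply, Pi.single_eq_same]; ring
  have h2 := hceil β hβ s hs0 hs1 hsub L 2 (fun _ => q) y R (fun _ => hq) hR hRs hRL
    (pair_separated_of_coord_sub_eq hRR' hR'L y μ hy)
  rw [torusE_centredProd_two, e0, e1] at h2
  exact h2

end Summit.QuantumFields.YangMills.Theorems.SubOnsetCeilings.Negative

end
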